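import Mathlib
import Summits.Ventures.Crystal3D.Theorems.StickyWulffConstantTextureLiminfTentTablesLocal
import Summits.Ventures.Crystal3D.StickySpheres.FccChunks
import Literature.MathematicalPhysics.StatisticalMechanics.FccSurfaceTension
import Literature.Barriers.AtomisticToContinuum.TetrahedralFrustrationRogers
import HarnessLib

/-!
# The tent certificate for fcc grains — (T1), part C: the geometric bridge

(File 3 of 3; see `StickyWulffConstantTextureLiminfTentTables.lean` for the overview.)  In the coefficient
model realised at `site n = (√2)⁻¹ • intVec (fccPoint n)` (nearest-neighbour distance `1`, cubic frame,
Wulff gauge `phiFcc`): gradients of the affine interpolants on the up/down tetrahedra and on the corner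
tetrahedra of an octahedron (`grad_tetUp`, `grad_tetDn`, `grad_corner`), `phiFcc (intVec w) = phiZ w`,
`phiFcc` of those gradients for `{0,1}` vertex values (`phiFcc_grad_tetUp/Dn/corner`), the cell volumes
`volume_tetUp = 1/(6√2)`, `volume_corner = 1/(12√2)` (as `rogersSimplex`), and the arithmetic
`cost_tet`, `cost_corner`: `|c| · phiFcc(∇f_A|_c)` is exactly `1/24` of the combinatorial cost of parts A/B.
WHAT THIS IS NOT: the FREE_f statement, (T2); F-C1 not moved.
-/

noncomputable section

namespace Summit.Ventures.Crystal3D.TentCertificate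

open Finset Summit.Ventures.Crystal3D MeasureTheory
open Literature.Geometry.DiscreteGeometry (intVec intVec_apply)
open Literature.MathematicalPhysics.StatisticalMechanics (phiFcc phiFcc_eq_sum_max phiFcc_smul phiFcc_neg)
open Literature.Barriers.AtomisticToContinuum (rogersSimplex edgeMap paramSimplex
  volume_rogersSimplex_eq_det det_edgeMap volume_paramSimplex)
open scoped RealInnerProductSpace

/-! ## Geometric identities (per-cell bridge): positions and frames -/

/-- Ambient space `EuclideanSpace ℝ (Fin 3)`. -/
abbrev E3 := EuclideanSpace ℝ (Fin 3)

/-- position of a site of the coefficient model (nn distance `1`, cubic frame). -/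
def site (n : Site) : E3 := (Real.sqrt 2)⁻¹ • intVec (fccPoint n)

/-- `fccPoint` is additive. -/
theorem fccPoint_add (a b : Site) : fccPoint (a + b) = fccPoint a + fccPoint b := by
  ext i; fin_cases i <;> simp [fccPoint] <;> ring

/-- `intVec` is additive. -/
theorem intVec_add (a b : Site) : intVec (a + b) = intVec a + intVec b := by
  ext i; simp [intVec_apply]

/-- `site` is additive. -/
theorem site_add (a b : Site) : site (a + b) = site a + site b := by
  simp only [site, fccPoint_add, intVec_add, smul_add]

/-- Inner product with an integer vector, in coordinates. -/
theorem inner_intVec (g : E3) (w : Site) : ⟪g, intVec w⟫ = g 0 * w 0 + g 1 * w 1 + g 2 * w 2 := by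
  simp [PiLp.inner_apply, intVec_apply, Fin.sum_univ_three, mul_comm]

/-- `⟪g, site q⟫ = (√2)⁻¹ · Σ_i g_i (fccPoint q)_i`. -/
theorem inner_site (g : E3) (q : Site) :
    ⟪g, site q⟫ = (Real.sqrt 2)⁻¹ * (g 0 * (q 0 + q 1) + g 1 * (q 0 + q 2) + g 2 * (q 1 + q 2)) := by
  rw [site, real_inner_smul_right, inner_intVec]
  simp [fccPoint]

/-! ## `phiFcc` on integer vectors -/


/-- `phiFcc` of an integer vector is the integer gauge `phiZ`. -/
theorem phiFcc_intVec (w : Site) : phiFcc (intVec w) = (phiZ (w 0) (w 1) (w 2) : ℝ) := by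
  rw [phiFcc_eq_sum_max]
  simp only [intVec_apply, phiZ]
  push_cast
  rfl

/-- `phiZ` only depends on absolute values. -/
theorem phiZ_abs (a b c : ℤ) : phiZ |a| |b| |c| = phiZ a b c := by
  simp [phiZ, abs_abs]

/-- `phiFcc` only sees absolute coordinates. -/
theorem phiFcc_eq_of_abs_eq {v v' : E3} (h : ∀ i, |v i| = |v' i|) : phiFcc v = phiFcc v' := by
  rw [phiFcc_eq_sum_max, phiFcc_eq_sum_max, h 0, h 1, h 2]

/-! ## Gradients of the affine interpolants -/


/-- the integer vector `N d` for real vertex data (as a real vector). -/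
def gradUp (u : Fin 4 → ℝ) : E3 :=
  !₂[(u 1 - u 0) + (u 2 - u 0) - (u 3 - u 0), (u 1 - u 0) - (u 2 - u 0) + (u 3 - u 0),
     -(u 1 - u 0) + (u 2 - u 0) + (u 3 - u 0)]

/-- **Gradient on the up-tetrahedron**: the affine function `⟪g,·⟫ + c` with values `u_j` at the
vertices `site (p + tetUpV j)` has `g = (√2/2)·N d`. -/
theorem grad_tetUp {p : Site} {g : E3} {c : ℝ} {u : Fin 4 → ℝ}
    (h : ∀ j : Fin 4, ⟪g, site (p + tetUpV j)⟫ + c = u j) :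
    g = (Real.sqrt 2 / 2) • gradUp u := by
  have hs : (0 : ℝ) < Real.sqrt 2 := by positivity
  have hs2 : Real.sqrt 2 * Real.sqrt 2 = 2 := Real.mul_self_sqrt (by norm_num)
  have h0 := h 0; have h1 := h 1; have h2 := h 2; have h3 := h 3
  simp only [site_add, inner_add_right, inner_site, tetUpV] at h0 h1 h2 h3
  simp only [Matrix.cons_val_zero, Matrix.cons_val_one, Matrix.cons_val] at h0 h1 h2 h3
  norm_num at h0 h1 h2 h3
  have e1 : (Real.sqrt 2)⁻¹ * (g 0 + g 1) = u 1 - u 0 := by linarith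
  have e2 : (Real.sqrt 2)⁻¹ * (g 0 + g 2) = u 2 - u 0 := by linarith
  have e3 : (Real.sqrt 2)⁻¹ * (g 1 + g 2) = u 3 - u 0 := by linarith
  have f1 : g 0 + g 1 = Real.sqrt 2 * (u 1 - u 0) := by
    rw [← e1, ← mul_assoc, mul_inv_cancel₀ hs.ne', one_mul]
  have f2 : g 0 + g 2 = Real.sqrt 2 * (u 2 - u 0) := by
    rw [← e2, ← mul_assoc, mul_inv_cancel₀ hs.ne', one_mul]
  have f3 : g 1 + g 2 = Real.sqrt 2 * (u 3 - u 0) := by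
    rw [← e3, ← mul_assoc, mul_inv_cancel₀ hs.ne', one_mul]
  ext i
  fin_cases i <;> simp [gradUp] <;> linarith

/-- **Gradient on the down-tetrahedron** (`site (p + tetDnV j) = site p − …`): `g = −(√2/2)·N d`. -/
theorem grad_tetDn {p : Site} {g : E3} {c : ℝ} {u : Fin 4 → ℝ}
    (h : ∀ j : Fin 4, ⟪g, site (p + tetDnV j)⟫ + c = u j) :
    g = -((Real.sqrt 2 / 2) • gradUp u) := by
  have hs : (0 : ℝ) < Real.sqrt 2 := by positivity
  have h0 := h 0; have h1 := h 1; have h2 := h 2; have h3 := h 3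
  simp only [site_add, inner_add_right, inner_site, tetDnV] at h0 h1 h2 h3
  simp only [Matrix.cons_val_zero, Matrix.cons_val_one, Matrix.cons_val] at h0 h1 h2 h3
  norm_num at h0 h1 h2 h3
  have e1 : (Real.sqrt 2)⁻¹ * (g 0 + g 1) = -(u 1 - u 0) := by linarith
  have e2 : (Real.sqrt 2)⁻¹ * (g 0 + g 2) = -(u 2 - u 0) := by linarith
  have e3 : (Real.sqrt 2)⁻¹ * (g 1 + g 2) = -(u 3 - u 0) := by linarith
  have f1 : g 0 + g 1 = Real.sqrt 2 * -(u 1 - u 0) := by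
    rw [← e1, ← mul_assoc, mul_inv_cancel₀ hs.ne', one_mul]
  have f2 : g 0 + g 2 = Real.sqrt 2 * -(u 2 - u 0) := by
    rw [← e2, ← mul_assoc, mul_inv_cancel₀ hs.ne', one_mul]
  have f3 : g 1 + g 2 = Real.sqrt 2 * -(u 3 - u 0) := by
    rw [← e3, ← mul_assoc, mul_inv_cancel₀ hs.ne', one_mul]
  ext i
  fin_cases i <;> simp [gradUp] <;> linarith

/-! ## Tetrahedron cost for `{0,1}` vertex values: `|T|·phiFcc(∇f) = e_T/12` -/

/-- Indicator of a Boolean as a real. -/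
def indR (b : Bool) : ℝ := if b then 1 else 0

/-- The real indicator is the cast of the integer one. -/
theorem indR_eq (b : Bool) : indR b = (ind b : ℝ) := by cases b <;> simp [indR, ind]

/-- the integer vector `N d` of a `{0,1}` pattern. -/
def NdZ (u : Fin 4 → Bool) : Site :=
  ![(ind (u 1) - ind (u 0)) + (ind (u 2) - ind (u 0)) - (ind (u 3) - ind (u 0)),
    (ind (u 1) - ind (u 0)) - (ind (u 2) - ind (u 0)) + (ind (u 3) - ind (u 0)),
    -(ind (u 1) - ind (u 0)) + (ind (u 2) - ind (u 0)) + (ind (u 3) - ind (u 0))]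

/-- For Boolean vertex values the up-tetrahedron gradient is the integer vector `NdZ`. -/
theorem gradUp_bool (u : Fin 4 → Bool) : gradUp (fun j => indR (u j)) = intVec (NdZ u) := by
  ext i
  fin_cases i <;> simp [gradUp, NdZ, intVec_apply, indR_eq]

/-- the 16-pattern table: `phiZ (N d) = e_T`. -/
theorem phiZ_NdZ_eq4 : ∀ u₀ u₁ u₂ u₃ : Bool,
    phiZ (NdZ ![u₀, u₁, u₂, u₃] 0) (NdZ ![u₀, u₁, u₂, u₃] 1) (NdZ ![u₀, u₁, u₂, u₃] 2) =
      eT4 ![u₀, u₁, u₂, u₃] := by decide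

/-- `phiZ (NdZ u) = eT4 u` for every Boolean pattern (16-pattern table). -/
theorem phiZ_NdZ_eq (u : Fin 4 → Bool) : phiZ (NdZ u 0) (NdZ u 1) (NdZ u 2) = eT4 u := by
  have hu : u = ![u 0, u 1, u 2, u 3] := by funext i; fin_cases i <;> rfl
  rw [hu]; exact phiZ_NdZ_eq4 _ _ _ _

/-- **Tetrahedron table, geometric form.**  If `⟪g,·⟫ + c` takes the `{0,1}` values `u` at the
vertices of `T⁺(p)` (or `T⁻(p)`), then `phiFcc g = (√2/2)·e_T(u)`; with `|T| = 1/(6√2)` this is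
`|T|·phiFcc g = e_T/12`. -/
theorem phiFcc_grad_tetUp {p : Site} {g : E3} {c : ℝ} {u : Fin 4 → Bool}
    (h : ∀ j : Fin 4, ⟪g, site (p + tetUpV j)⟫ + c = indR (u j)) :
    phiFcc g = Real.sqrt 2 / 2 * (eT4 u : ℝ) := by
  rw [grad_tetUp h, phiFcc_smul, abs_of_pos (by positivity), gradUp_bool, phiFcc_intVec]
  exact_mod_cast congrArg (fun z : ℤ => Real.sqrt 2 / 2 * (z : ℝ)) (phiZ_NdZ_eq u)

/-- `phiFcc` of the down-tetrahedron gradient for `{0,1}` vertex values is `(√2/2)·e_T`. -/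
theorem phiFcc_grad_tetDn {p : Site} {g : E3} {c : ℝ} {u : Fin 4 → Bool}
    (h : ∀ j : Fin 4, ⟪g, site (p + tetDnV j)⟫ + c = indR (u j)) :
    phiFcc g = Real.sqrt 2 / 2 * (eT4 u : ℝ) := by
  rw [grad_tetDn h, phiFcc_neg, phiFcc_smul, abs_of_pos (by positivity), gradUp_bool, phiFcc_intVec]
  exact_mod_cast congrArg (fun z : ℤ => Real.sqrt 2 / 2 * (z : ℝ)) (phiZ_NdZ_eq u)

/-- Arithmetic: `|T|·(√2/2)·e = e/12`. -/
theorem cost_tet (u : Fin 4 → Bool) :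
    1 / (6 * Real.sqrt 2) * (Real.sqrt 2 / 2 * (eT4 u : ℝ)) = (eT4 u : ℝ) / 12 := by
  have hs : (0 : ℝ) < Real.sqrt 2 := by positivity
  field_simp
  ring

/-! ## Octahedron corner tetrahedra: gradient and cost -/


/-- centre of the octahedron `O(p)` (the octahedral hole `fccPoint p + e_x`, scaled). -/
def centre (p : Site) : E3 := site p + (Real.sqrt 2)⁻¹ • intVec ![1, 0, 0]

/-- vertex index on axis `a` with direction `+` (`true`) / `−` (`false`):
x: `1 / 0`, y: `2 / 3`, z: `4 / 5`. -/
def octIdx : Fin 3 → Bool → Fin 6 :=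
  ![fun b => if b then 1 else 0, fun b => if b then 2 else 3, fun b => if b then 4 else 5]

/-- Sign of a Boolean as a real (`±1`). -/
def sgnR (b : Bool) : ℝ := if b then 1 else -1

/-- the chosen vertex on axis `a` sits at `centre p + (σ/√2) e_a`. -/
theorem site_octV (p : Site) (a : Fin 3) (b : Bool) :
    site (p + octV (octIdx a b)) = centre p + ((Real.sqrt 2)⁻¹ * sgnR b) • EuclideanSpace.single a 1 := by
  rw [site_add, centre, add_assoc]
  congr 1
  ext i
  fin_cases a <;> cases b <;> fin_cases i <;>
    simp [site, octV, octIdx, fccPoint, intVec_apply, sgnR]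
  all_goals ring

/-- **Gradient on a corner tetrahedron of `O(p)`**: with value `α` at the centre and `v a` at the
chosen vertex of axis `a` (`s a` = its direction), `g_a = √2·σ_a·(v_a − α)`. -/
theorem grad_corner {p : Site} {g : E3} {c α : ℝ} {v : Fin 3 → ℝ} (s : Fin 3 → Bool)
    (h0 : ⟪g, centre p⟫ + c = α)
    (h : ∀ a : Fin 3, ⟪g, site (p + octV (octIdx a (s a)))⟫ + c = v a) :
    ∀ a : Fin 3, g a = Real.sqrt 2 * sgnR (s a) * (v a - α) := by
  intro a
  have hs : (0 : ℝ) < Real.sqrt 2 := by positivity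
  have hs2 : Real.sqrt 2 * Real.sqrt 2 = 2 := Real.mul_self_sqrt (by norm_num)
  have ha := h a
  rw [site_octV, inner_add_right, real_inner_smul_right] at ha
  have hsingle : ⟪g, EuclideanSpace.single a (1 : ℝ)⟫ = g a := by
    simp [EuclideanSpace.inner_single_right]
  rw [hsingle] at ha
  have e : (Real.sqrt 2)⁻¹ * sgnR (s a) * g a = v a - α := by linarith
  have hsg : sgnR (s a) * sgnR (s a) = 1 := by cases s a <;> simp [sgnR]
  calc g a = Real.sqrt 2 * sgnR (s a) * ((Real.sqrt 2)⁻¹ * sgnR (s a) * g a) := by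
        have : Real.sqrt 2 * sgnR (s a) * ((Real.sqrt 2)⁻¹ * sgnR (s a) * g a) =
            (Real.sqrt 2 * (Real.sqrt 2)⁻¹) * (sgnR (s a) * sgnR (s a)) * g a := by ring
        rw [this, mul_inv_cancel₀ hs.ne', hsg, one_mul, one_mul]
    _ = Real.sqrt 2 * sgnR (s a) * (v a - α) := by rw [e]

/-- `2 w` for a `{0,1}` vertex value `v` and doubled centre value `tα ∈ {0,1,2}`. -/
def cw' (v : Bool) (tα : ℤ) : ℤ := 2 * ind v - tα

/-- **Corner-tetrahedron table, geometric form.**  With `{0,1}` vertex values `v` and centre value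
`α = tα/2`, `phiFcc g = (√2/2)·phiZ(2w)`; with `|corner| = 1/(12√2)` this is `phiZ(2w)/24`. -/
theorem phiFcc_grad_corner {p : Site} {g : E3} {c : ℝ} {v : Fin 3 → Bool} {tα : ℤ}
    (s : Fin 3 → Bool) (h0 : ⟪g, centre p⟫ + c = (tα : ℝ) / 2)
    (h : ∀ a : Fin 3, ⟪g, site (p + octV (octIdx a (s a)))⟫ + c = indR (v a)) :
    phiFcc g = Real.sqrt 2 / 2 *
      (phiZ (cw' (v 0) tα) (cw' (v 1) tα) (cw' (v 2) tα) : ℝ) := by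
  have hs : (0 : ℝ) < Real.sqrt 2 := by positivity
  have hg := grad_corner (v := fun a => indR (v a)) s h0 h
  -- |g a| = (√2/2)·|2 v_a − tα|
  have habs : ∀ a : Fin 3, |g a| = |((Real.sqrt 2 / 2) • intVec ![cw' (v 0) tα, cw' (v 1) tα,
      cw' (v 2) tα]) a| := by
    intro a
    rw [hg a, PiLp.smul_apply, smul_eq_mul, intVec_apply, abs_mul, abs_mul, abs_mul]
    have hsg : |sgnR (s a)| = 1 := by cases s a <;> simp [sgnR]
    rw [hsg, mul_one, abs_of_pos hs, abs_of_pos (by positivity : (0:ℝ) < Real.sqrt 2 / 2)]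
    have hv : |indR (v a) - (tα : ℝ) / 2| = |((cw' (v a) tα : ℤ) : ℝ)| / 2 := by
      rw [cw', indR_eq]; push_cast
      rw [show ((ind (v a) : ℝ) - (tα : ℝ) / 2) = (2 * (ind (v a) : ℝ) - tα) / 2 by ring, abs_div,
        abs_two]
    rw [hv]
    fin_cases a <;> simp <;> ring
  rw [phiFcc_eq_of_abs_eq habs, phiFcc_smul, abs_of_pos (by positivity), phiFcc_intVec]
  simp

/-- Arithmetic: `|corner|·(√2/2)·z = z/24`. -/
theorem cost_corner (z : ℤ) :
    1 / (12 * Real.sqrt 2) * (Real.sqrt 2 / 2 * (z : ℝ)) = (z : ℝ) / 24 := by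
  have hs : (0 : ℝ) < Real.sqrt 2 := by positivity
  field_simp
  ring

/-! ## Volumes of the reference cells (`rogersSimplex` = vertex + `{Σ tᵢ cᵢ : t ≥ 0, Σ t ≤ 1}`) -/

/-- `|T⁺(p)| = 1/(6√2)`. -/
theorem volume_tetUp (p : Site) :
    volume (rogersSimplex (site p) (fun i : Fin 3 => site (p + tetUpV i.succ) - site p)) =
      ENNReal.ofReal (1 / (6 * Real.sqrt 2)) := by
  have hs : (0 : ℝ) < Real.sqrt 2 := by positivity
  have hs2 : Real.sqrt 2 * Real.sqrt 2 = 2 := Real.mul_self_sqrt (by norm_num)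
  have hr0 : 0 < (Real.sqrt 2)⁻¹ := inv_pos.mpr hs
  have hr2 : (Real.sqrt 2)⁻¹ * (Real.sqrt 2)⁻¹ = 1 / 2 := by
    rw [← mul_inv, hs2]; norm_num
  have hR : (1 : ℝ) / (6 * Real.sqrt 2) = (Real.sqrt 2)⁻¹ / 6 := by
    field_simp
  rw [hR, volume_rogersSimplex_eq_det, det_edgeMap, volume_paramSimplex,
    ← ENNReal.ofReal_mul (abs_nonneg _)]
  congr 1
  have hc : ∀ i : Fin 3, site (p + tetUpV i.succ) - site p = site (tetUpV i.succ) := by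
    intro i; rw [site_add]; abel
  simp only [hc]
  rw [Matrix.det_fin_three]
  simp [site, tetUpV, fccPoint, intVec_apply, Matrix.of_apply]
  generalize (Real.sqrt 2)⁻¹ = r at hr0 hr2 ⊢
  have h3 : -(r * r * r) - r * r * r = -r := by
    rw [show -(r * r * r) - r * r * r = -(2 * (r * r) * r) by ring, hr2]; ring
  rw [h3, abs_neg, abs_of_pos hr0]
  ring

/-- `|corner tetrahedron of O(p)| = 1/(12√2)` (edges `(σ_a/√2) e_a`). -/
theorem volume_corner (p : Site) (s : Fin 3 → Bool) :
    volume (rogersSimplex (centre p) (fun a : Fin 3 => site (p + octV (octIdx a (s a))) - centre p)) =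
      ENNReal.ofReal (1 / (12 * Real.sqrt 2)) := by
  have hs : (0 : ℝ) < Real.sqrt 2 := by positivity
  have hs2 : Real.sqrt 2 * Real.sqrt 2 = 2 := Real.mul_self_sqrt (by norm_num)
  have hr0 : 0 < (Real.sqrt 2)⁻¹ := inv_pos.mpr hs
  have hr2 : (Real.sqrt 2)⁻¹ * (Real.sqrt 2)⁻¹ = 1 / 2 := by
    rw [← mul_inv, hs2]; norm_num
  have hR : (1 : ℝ) / (12 * Real.sqrt 2) = (Real.sqrt 2)⁻¹ / 12 := by
    field_simp
  rw [hR, volume_rogersSimplex_eq_det, det_edgeMap, volume_paramSimplex,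
    ← ENNReal.ofReal_mul (abs_nonneg _)]
  congr 1
  have hc : ∀ a : Fin 3, site (p + octV (octIdx a (s a))) - centre p =
      ((Real.sqrt 2)⁻¹ * sgnR (s a)) • EuclideanSpace.single a (1 : ℝ) := by
    intro a; rw [site_octV]; abel
  simp only [hc]
  rw [Matrix.det_fin_three]
  have hsg : ∀ b : Bool, |sgnR b| = 1 := by intro b; cases b <;> simp [sgnR]
  simp [Matrix.of_apply, PiLp.smul_apply]
  simp only [hsg, mul_one, abs_of_pos hs]
  generalize (Real.sqrt 2)⁻¹ = r at hr0 hr2 ⊢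
  have h3 : r * r * r = r / 2 := by
    rw [show r * r * r = (r * r) * r by ring, hr2]; ring
  linear_combination (1 / 6 : ℝ) * h3


end Summit.Ventures.Crystal3D.TentCertificate
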